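import Summits.AtomisticToContinuum.Crystallization.Theorems.FreeSplittingCertificatesRadiusLadder
import Literature.MathematicalPhysics.StatisticalMechanics.LennardJonesClusters

/-!
# `FiniteRangeSplitting` (stmt-AtomisticToContinuum-12559): packing lemmas for the hard-core end of the `δ`-ladder

Support file for crux r2 of route `FreeSplittingCertificates` (block-2b unit `b2b-freesplit-A`, gen 11); companion of
`…RadiusLadderHalfRule`, which decides the crux's instances `δ ≥ 4/3` with the half rule.
VALUE = lemmas for a theorem deciding crux instances — NOT summit progress.

* `feasible_mono_sep` — feasibility of a fixed rule is monotone in the hard core.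
* `card_near_le` — VOLUME PACKING at a site: in a `δ`-separated configuration at most `(2t/δ + 1)³ − 1` other
  points lie within distance `< t` of a given point (`card_le_of_separated_of_dist_le` applied to the point
  together with its near neighbours).
* `sum_inv_pow_six_far_le` — the FAR SHELL SUM: in an `r`-separated configuration the points at distance `≥ 4r`
  from `xᵢ` have `∑ |xᵢ − x_k|⁻⁶ ≤ (1331/512)·r⁻⁶` (the argument of the tree's `sum_inv_pow_six_le`, restricted
  to shells `b = ⌊|xᵢ − x_k|/r⌋ ≥ 4`: `≤ (2b+3)³ ≤ (11/4)³ b³` points per shell, `∑_{b ≥ 4} b⁻² ≤ 1/2`).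
-/

noncomputable section
namespace Summit.AtomisticToContinuum.Crystallization.Theorems.StrictSplittingRuleBirth

open scoped BigOperators Classical
open Literature.MathematicalPhysics.StatisticalMechanics

/-! ## Monotonicity in the hard core -/

/-- Feasibility of a fixed rule is monotone in the hard core: a rule feasible at `δ` is feasible at every
`δ' ≥ δ`. -/
theorem feasible_mono_sep {δ δ' R : ℝ} (hδ : δ ≤ δ') {Φ : EuclideanSpace ℝ (Fin 3) → Finset (EuclideanSpace ℝ (Fin 3)) → ℝ} (hf : Feasible δ R Φ) :
    Feasible δ' R Φ :=
  fun N x hx i => hf N x (fun a b hab => hδ.trans (hx a b hab)) i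

/-! ## Packing: neighbour counts and the far tail -/

/-- **Neighbour count by volume**: in a `δ`-separated configuration at most `(2t/δ + 1)³ − 1` other points lie
within distance `< t` of a given point. [folklore] -/
theorem card_near_le {δ : ℝ} (hδ : 0 < δ) {N : ℕ} {x : Fin N → EuclideanSpace ℝ (Fin 3)} (hx : Sep δ x) (i : Fin N) {t : ℝ}
    (ht : 0 ≤ t) :
    ((((Finset.univ.erase i).filter fun j => dist (x i) (x j) < t).card : ℕ) : ℝ) ≤
      (2 * t / δ + 1) ^ 3 - 1 := by
  set F := (Finset.univ.erase i).filter fun j => dist (x i) (x j) < t with hF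
  have hinj := perturbative_injective_of_sep hδ hx
  have hiF : i ∉ F := by simp [hF]
  have hcard : ((insert i F).image x).card = F.card + 1 := by
    rw [Finset.card_image_of_injective _ hinj, Finset.card_insert_of_notMem hiF]
  have key := card_le_of_separated_of_dist_le ((insert i F).image x) (x i) hδ ht ?_ ?_
  · rw [finrank_euclideanSpace_fin, hcard] at key
    push_cast at key
    linarith
  · intro c hc
    obtain ⟨j, hj, rfl⟩ := Finset.mem_image.1 hc
    rcases Finset.mem_insert.1 hj with rfl | hjF
    · simp [ht]
    · rw [dist_comm]
      exact (Finset.mem_filter.1 hjF).2.le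
  · intro c hc d hd hne
    obtain ⟨j, -, rfl⟩ := Finset.mem_image.1 hc
    obtain ⟨l, -, rfl⟩ := Finset.mem_image.1 hd
    exact hx j l fun h => hne (h ▸ rfl)

/-- **Far shell sum.**  In an `r`-separated configuration (`r > 0`), the points at distance `≥ 4r` from `xᵢ`
have `∑ |xᵢ − x_k|⁻⁶ ≤ (1331/512)·r⁻⁶`: shell `⌊|xᵢ − x_k|/r⌋ = b ≥ 4` holds `≤ (2b+3)³ ≤ (11/4)³ b³` points,
each contributing `≤ (br)⁻⁶`, and `∑_{b ≥ 4} b⁻³ ≤ ¼ ∑_{b ≥ 4} b⁻² ≤ ⅛` (the argument of the tree's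
`sum_inv_pow_six_le`, restricted to far shells). [folklore] -/
theorem sum_inv_pow_six_far_le {N : ℕ} (x : Fin N → EuclideanSpace ℝ (Fin 3)) {r : ℝ} (hr : 0 < r)
    (hsep : ∀ k l, k ≠ l → r ≤ dist (x k) (x l)) (i : Fin N) :
    ∑ k ∈ (Finset.univ.erase i).filter (fun k => 4 * r ≤ dist (x i) (x k)), (dist (x i) (x k))⁻¹ ^ 6 ≤
      1331 / 512 * r⁻¹ ^ 6 := by
  set s := (Finset.univ.erase i).filter (fun k => 4 * r ≤ dist (x i) (x k)) with hs_def
  set m : Fin N → ℕ := fun k => ⌊dist (x i) (x k) / r⌋₊ with hm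
  set t := s.image m with ht_def
  have hmem : ∀ k ∈ s, m k ∈ t := fun k hk => Finset.mem_image_of_mem m hk
  have hks : ∀ k ∈ s, 4 * r ≤ dist (x i) (x k) := fun k hk => (Finset.mem_filter.1 hk).2
  have hm4 : ∀ k ∈ s, 4 ≤ m k := fun k hk => by
    have h4 : (4 : ℝ) ≤ dist (x i) (x k) / r := by rw [le_div_iff₀ hr]; exact hks k hk
    have := Nat.floor_le_floor h4
    simpa using this
  have hm1 : ∀ k ∈ s, 1 ≤ m k := fun k hk => le_trans (by norm_num) (hm4 k hk)
  have hmle : ∀ k ∈ s, r * m k ≤ dist (x i) (x k) := fun k hk => by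
    have := Nat.floor_le (div_nonneg dist_nonneg hr.le : 0 ≤ dist (x i) (x k) / r)
    rwa [le_div_iff₀ hr, mul_comm] at this
  have hmlt : ∀ k ∈ s, dist (x i) (x k) < (m k + 1) * r := fun k hk => by
    have := Nat.lt_floor_add_one (dist (x i) (x k) / r)
    rwa [div_lt_iff₀ hr] at this
  -- termwise: `|xᵢ - x_k|⁻⁶ ≤ (r m_k)⁻⁶`
  have step1 : ∑ k ∈ s, (dist (x i) (x k))⁻¹ ^ 6 ≤ ∑ k ∈ s, r⁻¹ ^ 6 * ((m k : ℝ))⁻¹ ^ 6 := by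
    refine Finset.sum_le_sum fun k hk => ?_
    rw [← mul_pow, ← mul_inv]
    have h0 : 0 < r * m k := mul_pos hr (by exact_mod_cast hm1 k hk)
    exact pow_le_pow_left₀ (inv_nonneg.2 dist_nonneg) (inv_anti₀ h0 (hmle k hk)) _
  -- regroup by shells
  have step2 : ∑ k ∈ s, r⁻¹ ^ 6 * ((m k : ℝ))⁻¹ ^ 6 =
      ∑ b ∈ t, ((s.filter fun k => m k = b).card : ℝ) * (r⁻¹ ^ 6 * ((b : ℝ))⁻¹ ^ 6) := by
    have := Finset.sum_fiberwise_of_maps_to' hmem (fun b : ℕ => r⁻¹ ^ 6 * ((b : ℝ))⁻¹ ^ 6)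
    simp only [Finset.sum_const, nsmul_eq_mul] at this
    exact this.symm
  -- each shell holds at most `(2b+3)³` particles
  have step3 : ∀ b ∈ t, ((s.filter fun k => m k = b).card : ℝ) ≤ (2 * (b : ℝ) + 3) ^ 3 := by
    intro b hb
    set F := s.filter fun k => m k = b with hF
    have hinj : Set.InjOn x F := fun k _ l _ hkl => by
      by_contra hne
      have := hsep k l hne
      rw [hkl, dist_self] at this
      exact absurd this (not_le.2 hr)
    rw [← Finset.card_image_of_injOn hinj]
    have hR : (0 : ℝ) ≤ ((b : ℝ) + 1) * r := by positivity
    have := card_le_of_separated_of_dist_le (F.image x) (x i) hr hR ?_ ?_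
    · rw [finrank_euclideanSpace_fin] at this
      convert this using 2
      field_simp
      ring
    · intro c hc
      obtain ⟨k, hk, rfl⟩ := Finset.mem_image.1 hc
      obtain ⟨hks', hkb⟩ := Finset.mem_filter.1 hk
      rw [dist_comm]
      have := hmlt k hks'
      rw [hkb] at this
      exact this.le
    · intro c hc c' hc' hne
      obtain ⟨k, -, rfl⟩ := Finset.mem_image.1 hc
      obtain ⟨l, -, rfl⟩ := Finset.mem_image.1 hc'
      exact hsep k l fun h => hne (h ▸ rfl)
  -- numerics per shell: `(2b+3)³ b⁻⁶ ≤ (1331/256) b⁻²` for `b ≥ 4`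
  have step4 : ∀ b ∈ t, (2 * (b : ℝ) + 3) ^ 3 * (r⁻¹ ^ 6 * ((b : ℝ))⁻¹ ^ 6) ≤
      1331 / 256 * r⁻¹ ^ 6 * ((b : ℝ) ^ 2)⁻¹ := by
    intro b hb
    obtain ⟨k, hk, rfl⟩ := Finset.mem_image.1 hb
    have hb4 : (4 : ℝ) ≤ (m k : ℝ) := by exact_mod_cast hm4 k hk
    set β : ℝ := (m k : ℝ)
    have hβ : 0 < β := by linarith
    have hr6 : 0 < r⁻¹ ^ 6 := by positivity
    have key : (2 * β + 3) ^ 3 * (β⁻¹) ^ 6 ≤ 1331 / 256 * (β ^ 2)⁻¹ := by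
      rw [inv_pow, ← div_eq_mul_inv, ← div_eq_mul_inv,
        div_le_div_iff₀ (by positivity) (by positivity)]
      have h5 : (2 * β + 3) ^ 3 ≤ (11 / 4 * β) ^ 3 :=
        pow_le_pow_left₀ (by positivity) (by linarith) 3
      have h6 : 0 ≤ β ^ 3 * (β - 4) := mul_nonneg (pow_nonneg hβ.le 3) (by linarith)
      nlinarith [mul_le_mul_of_nonneg_right h5 (sq_nonneg β)]
    calc (2 * β + 3) ^ 3 * (r⁻¹ ^ 6 * (β⁻¹) ^ 6) = r⁻¹ ^ 6 * ((2 * β + 3) ^ 3 * (β⁻¹) ^ 6) := by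
          ring
      _ ≤ r⁻¹ ^ 6 * (1331 / 256 * (β ^ 2)⁻¹) := mul_le_mul_of_nonneg_left key hr6.le
      _ = 1331 / 256 * r⁻¹ ^ 6 * (β ^ 2)⁻¹ := by ring
  -- `∑_{b ∈ t} b⁻² ≤ 1/2` (all `b ≥ 4`)
  have step5 : ∑ b ∈ t, ((b : ℝ) ^ 2)⁻¹ ≤ 1 / 2 := by
    have hsub : t ⊆ Finset.Ioo 3 (t.sup id + 1) := fun b hb => by
      rw [Finset.mem_Ioo]
      obtain ⟨k, hk, rfl⟩ := Finset.mem_image.1 hb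
      exact ⟨lt_of_lt_of_le (by norm_num) (hm4 k hk), Nat.lt_succ_of_le (Finset.le_sup (f := id) hb)⟩
    have h2 := sum_Ioo_inv_sq_le (α := ℝ) 3 (t.sup id + 1)
    calc ∑ b ∈ t, ((b : ℝ) ^ 2)⁻¹ ≤ ∑ b ∈ Finset.Ioo 3 (t.sup id + 1), ((b : ℝ) ^ 2)⁻¹ :=
          Finset.sum_le_sum_of_subset_of_nonneg hsub fun b _ _ => by positivity
      _ ≤ 2 / (3 + 1) := by exact_mod_cast h2
      _ = 1 / 2 := by norm_num
  have hr6 : 0 ≤ r⁻¹ ^ 6 := by positivity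
  calc ∑ k ∈ s, (dist (x i) (x k))⁻¹ ^ 6
      ≤ ∑ b ∈ t, ((s.filter fun k => m k = b).card : ℝ) * (r⁻¹ ^ 6 * ((b : ℝ))⁻¹ ^ 6) :=
        step1.trans_eq step2
    _ ≤ ∑ b ∈ t, (2 * (b : ℝ) + 3) ^ 3 * (r⁻¹ ^ 6 * ((b : ℝ))⁻¹ ^ 6) :=
        Finset.sum_le_sum fun b hb => mul_le_mul_of_nonneg_right (step3 b hb) (by positivity)
    _ ≤ ∑ b ∈ t, 1331 / 256 * r⁻¹ ^ 6 * ((b : ℝ) ^ 2)⁻¹ := Finset.sum_le_sum step4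
    _ = 1331 / 256 * r⁻¹ ^ 6 * ∑ b ∈ t, ((b : ℝ) ^ 2)⁻¹ := by rw [Finset.mul_sum]
    _ ≤ 1331 / 256 * r⁻¹ ^ 6 * (1 / 2) := mul_le_mul_of_nonneg_left step5 (by positivity)
    _ = 1331 / 512 * r⁻¹ ^ 6 := by ring

end Summit.AtomisticToContinuum.Crystallization.Theorems.StrictSplittingRuleBirth

end
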